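import Summits.HodgeConjecture.HodgeConjecture.Theorems.F0P3cStCharTSSubmersionPullback   -- ★ p852078 (F0P3-p04) FILE A `exists_nhds_setLIntegral_comp_lt_top`; brings ★ D2 `SubmersionChart`, ★ D2-lin, ★ D1
import Literature.NumberTheory.Automorphic.LocalFieldHomogeneousNegPower                 -- ★ p852049 (this seat) the template `exists_nhds_setLIntegral_lt_top_of_dilation`; brings ★ (D3a) `lintegral_coe_normAbs_rpow_neg_lt_top`
import Literature.NumberTheory.GaloisRepresentations.LocalFieldFiniteExtension          -- ★ `nontriviallyNormedField`, `completeSpace_…`, `isUltrametricDist_nontriviallyNormedField` (ruling R1)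
import Mathlib.Analysis.Calculus.FDeriv.Bilinear
import Mathlib.Analysis.Calculus.FDeriv.Prod
import Mathlib.Analysis.Normed.Field.ProperSpace
import Mathlib.LinearAlgebra.Matrix.BilinearForm
import Mathlib.LinearAlgebra.Matrix.Nondegenerate
import Mathlib.Topology.MetricSpace.Ultra.Pi
import Mathlib.Topology.Instances.Matrix
import HarnessLib

/-!
# F0 · P3c · ROAD «HC-D», brick (D3b) «MODEL INTEGRAL, QUADRATIC FORM»: `|Q|^{−s} ∈ L¹_loc(Fⁿ)` for a non-degenerate quadratic form `Q` over a
# non-archimedean local field (`s < 1`, `2s < n`; in particular `|Q|^{−1/2}` on `F³`)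

Cell `pub/hodgecm-mathlib`, crux H413 = `stmt-HodgeConjecture-24833` (lane `--supports … --as helper`), route HCCMUnconditional; ROAD «HC-D» (LEAD F0P3a-plan T14-10;
holder ∕ dealer F0P2-p01 (g23), CENSUS-HCD v1 764fd71ae1289285 §1 (ii), §2 row D3 (b); DEAL 2026-09-02T16:16:05Z), seat F0P3b-p01 (g18) (census
`F0/P3/F0P3b-p01/g18/hcd/CENSUS-D3bc.v1.F0P3bp01g18.md`).  THEOREMS ONLY (no definition ∕ instance ∕ notation ∕ named fact ∕ `sorry`); ★-only imports.
`Theorems/`-level and not `Literature/` (the deal said `Literature/NumberTheory/Automorphic/LocalFieldQuadraticFormNegHalf.lean`) for the same reason as ★ FILE A: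
the zero-point input ★ D2 ∕ ★ FILE A are `Summits` modules.  HONEST LABEL: count-neutral; HC_CM is proved only modulo the printed citations (hLiu418 =
`stmt-HodgeConjecture-24832`, h413 = `stmt-HodgeConjecture-24833`) until rung 0 closes.

## Statement (HEAD `forall_exists_nhds_setLIntegral_quadraticForm_rpow_neg_lt_top`)

`F` a non-archimedean local field (`[Field F] [ValuativeRel F] [TopologicalSpace F] [IsNonarchimedeanLocalField F]`, Borel, `μ` an additive Haar measure on `F`),
`B : Matrix (Fin n) (Fin n) F` SYMMETRIC with `det B ≠ 0`, `(2 : F) ≠ 0`, `n ≠ 0`, and a real exponent with `s < 1` and `2s < n`.  Then EVERY point `y : Fin n → F` has a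
neighbourhood `U` with
  `∫⁻ x in U, (↑|x ⬝ B x|)^{−s} ∂(Measure.pi μ) < ∞`
(integrand in the cell's currency `normAbs F`, ruling R2; `ℝ≥0∞`-valued `rpow`, `= ⊤` on the null cone only).  Corollary `…_neg_half_…`: `n = 3`, `s = 1/2` — the model
singularity of type `(a,a,b)` in (HC-D) for `U(3)` [HarishChandra1970, Part VII §1 Thm. 15: `|η|^{−1/2}` is locally integrable; near a semisimple element with
centraliser `U(2) × U(1)` the invariant `η` is, to first order, a non-degenerate ternary quadratic form on the Lie algebra slice — bricks D5(ii)∕(CO) of the road dock here].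

## Proof (three ★ inputs and the ultrametric constancy of `|·|`)

(1) AWAY FROM THE CONE (§1, any continuous `f`): if `f y ≠ 0` then `|f x| = |f y|` near `y` (`|f x − f y| < |f y|`, ★ `normAbs_add_eq_of_lt`), so the integrand is constant on a
compact neighbourhood.  (2) ON THE CONE OFF THE ORIGIN (§3–§4): `Q` has strict derivative `v ↦ 2 (y ⬝ B v)` at `y` (a continuous bilinear form composed with the diagonal,
Mathlib `IsBoundedBilinearMap.hasStrictFDerivAt`, for the valuation norm `nontriviallyNormedField F` of ruling R1 — used inside proofs only), which is ONTO `F` when `y ≠ 0`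
(`B y ≠ 0` as `det B ≠ 0`, and `2 ≠ 0`); ★ FILE A `exists_nhds_setLIntegral_comp_lt_top` (★ D2 submersion chart + ★ D2-lin) pulls the finiteness of `∫⁻_𝒪 |a|^{−s} da`
(★ (D3a), `s < 1`) back along `Q`.  (3) THE ORIGIN (§5): `Q (ϖ x) = ϖ² Q x`, so the integrand is homogeneous of weight `κ = q^{2s}` under the dilation `x ↦ ϖ x` of modulus
`q^{−n}`; `κ q^{−n} < 1` iff `2s < n`, and ★ `exists_nhds_setLIntegral_lt_top_of_dilation` (shell decomposition of a ball at `0`, geometric series) concludes.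

## References
* [HarishChandra1970] Harish-Chandra, *Harmonic analysis on reductive p-adic groups*, LNM 162 (1970), Part VII §1, Thm. 15.
* [WeilBNT1967] A. Weil, *Basic Number Theory* (1967), Ch. I §2 (ultrametric absolute value), §4; Ch. II §1 (Haar measure on `Kⁿ`, modulus of a dilation).
* [Schikhof1984] W. H. Schikhof, *Ultrametric Calculus* (1984), §27 (strict differentiability).
* [Tate1950] J. Tate, *Fourier analysis in number fields and Hecke's zeta-functions* (1950), §2.4 (`∫_𝒪 |x|^{s−1} dx`).
-/

set_option autoImplicit false
-- the mandated namespace has the single-problem summit's repeated segment (`HodgeConjecture.HodgeConjecture`)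
set_option linter.dupNamespace false

noncomputable section

open MeasureTheory MeasureTheory.Measure ValuativeRel Filter Topology Set Matrix
open scoped NNReal ENNReal Pointwise
open Literature.NumberTheory.GaloisRepresentations.IsNonarchimedeanLocalField
open Literature.NumberTheory.Automorphic Literature.NumberTheory.Automorphic.LocalFieldHaar
open Summit.HodgeConjecture.HodgeConjecture.Cruxes.H413.F0P3cStCharTSSubmersionPullback

namespace Summit.HodgeConjecture.HodgeConjecture.Cruxes.H413.F0P3cStCharTSQuadraticFormNegHalf

/-! ## §1 Away from the zero set: `|f|^{−s}` is locally constant, hence locally integrable (any continuous `f`, any real `s`) -/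

section OffZero

variable {F : Type*} [Field F] [ValuativeRel F] [TopologicalSpace F] [IsNonarchimedeanLocalField F]
  [MeasurableSpace F] [BorelSpace F] (μ : Measure F) [μ.IsAddHaarMeasure] {n : ℕ}

/-- **Local finiteness of `∫⁻ |f|^{−s}` at a point where `f ≠ 0`.**  For a continuous `f : Fⁿ → F` and `f y ≠ 0`, `|f| = |f y|` on a neighbourhood of `y` (ultrametric
inequality), so `y` has a (compact) neighbourhood on which `∫⁻ (↑|f x|)^{−s} ∂μⁿ` is finite. [cite: WeilBNT1967, Ch. I §2] -/
theorem exists_nhds_setLIntegral_rpow_neg_lt_top_of_ne_zero {f : (Fin n → F) → F} (hf : Continuous f) (s : ℝ) {y : Fin n → F} (hy : f y ≠ 0) :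
    ∃ U ∈ 𝓝 y, ∫⁻ x in U, ((normAbs F (f x) : ℝ≥0∞)) ^ (-s) ∂(Measure.pi fun _ : Fin n => μ) < ∞ := by
  haveI := sigmaCompactSpace_of_isNonarchimedeanLocalField F
  haveI := secondCountableTopology_localField F
  haveI : T2Space F := (isLocalField F).toT2Space
  obtain ⟨K, hKc, hKy⟩ := exists_compact_mem_nhds y
  have hpos : 0 < normAbs F (f y) := pos_iff_ne_zero.2 ((map_ne_zero (normAbs F)).2 hy)
  have hVo : IsOpen {x : Fin n → F | normAbs F (f x - f y) < normAbs F (f y)} :=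
    isOpen_lt (continuous_normAbs.comp (hf.sub continuous_const)) continuous_const
  have hVy : y ∈ {x : Fin n → F | normAbs F (f x - f y) < normAbs F (f y)} := by
    simp only [mem_setOf_eq, sub_self, map_zero]; exact hpos
  refine ⟨K ∩ {x | normAbs F (f x - f y) < normAbs F (f y)}, Filter.inter_mem hKy (hVo.mem_nhds hVy), ?_⟩
  have hconst : ∀ x ∈ K ∩ {x | normAbs F (f x - f y) < normAbs F (f y)},
      ((normAbs F (f x) : ℝ≥0∞)) ^ (-s) = ((normAbs F (f y) : ℝ≥0∞)) ^ (-s) := by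
    rintro x ⟨-, hx⟩
    have h1 : normAbs F (f x) = normAbs F (f y) := by
      have h := normAbs_add_eq_of_lt (a := f y) (t := f x - f y) hx
      rwa [add_sub_cancel] at h
    rw [h1]
  rw [setLIntegral_congr_fun (hKc.measurableSet.inter hVo.measurableSet) hconst, setLIntegral_const]
  refine ENNReal.mul_lt_top ?_ ((measure_mono inter_subset_left).trans_lt hKc.measure_lt_top)
  rw [← ENNReal.coe_rpow_of_ne_zero hpos.ne']
  exact ENNReal.coe_lt_top

end OffZero

/-! ## §2 Algebra of the quadratic form `Q x = x ⬝ B x` of a symmetric matrix -/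

section Algebra

variable {R : Type*} [CommRing R] {n : ℕ}

/-- Homogeneity of degree two: `Q (c x) = c² Q x`. [cite: WeilBNT1967, Ch. I §2] -/
theorem dotProduct_mulVec_smul_self (B : Matrix (Fin n) (Fin n) R) (c : R) (x : Fin n → R) :
    (c • x) ⬝ᵥ B *ᵥ (c • x) = c ^ 2 * (x ⬝ᵥ B *ᵥ x) := by
  rw [mulVec_smul, dotProduct_smul, smul_dotProduct, smul_eq_mul, smul_eq_mul, sq, mul_assoc]

/-- Symmetry of the bilinear form of a symmetric matrix: `v ⬝ B y = y ⬝ B v`. [cite: WeilBNT1967, Ch. I §2] -/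
theorem dotProduct_mulVec_symm_of_isSymm {B : Matrix (Fin n) (Fin n) R} (hB : B.IsSymm) (v y : Fin n → R) :
    v ⬝ᵥ B *ᵥ y = y ⬝ᵥ B *ᵥ v := by
  rw [dotProduct_mulVec, dotProduct_comm, ← mulVec_transpose, hB.eq]

/-- The bilinear form against a basis vector: `y ⬝ B eᵢ = (B y) i` for symmetric `B`. [cite: WeilBNT1967, Ch. I §2] -/
theorem dotProduct_mulVec_single_one_of_isSymm {B : Matrix (Fin n) (Fin n) R} (hB : B.IsSymm) (y : Fin n → R) (i : Fin n) :
    y ⬝ᵥ B *ᵥ Pi.single i 1 = (B *ᵥ y) i := by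
  rw [← dotProduct_mulVec_symm_of_isSymm hB, single_one_dotProduct]

/-- Expansion at a point: `Q (y + v) = Q y + 2 (y ⬝ B v) + Q v` for symmetric `B`. [cite: WeilBNT1967, Ch. I §2] -/
theorem dotProduct_mulVec_add_self {B : Matrix (Fin n) (Fin n) R} (hB : B.IsSymm) (y v : Fin n → R) :
    (y + v) ⬝ᵥ B *ᵥ (y + v) = y ⬝ᵥ B *ᵥ y + 2 * (y ⬝ᵥ B *ᵥ v) + v ⬝ᵥ B *ᵥ v := by
  rw [mulVec_add, add_dotProduct, dotProduct_add, dotProduct_add, dotProduct_mulVec_symm_of_isSymm hB v y]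
  ring

end Algebra

/-! ## §3 The strict derivative of `Q` for the valuation norm (ruling R1: `nontriviallyNormedField F` inside statements∕proofs via `letI`, never an instance) -/

section Deriv

variable {F : Type*} [Field F] [ValuativeRel F] [TopologicalSpace F] [IsNonarchimedeanLocalField F] {n : ℕ}

/-- **`Q` is strictly differentiable with derivative `v ↦ 2 (y ⬝ B v)` at `y`** (for the valuation norm on `F` and the sup norm on `Fⁿ`): the quadratic form is the continuous
bilinear form `(x, z) ↦ x ⬝ B z` composed with the diagonal.  Existential in the continuous linear map (no definition). [cite: Schikhof1984, §27] -/
theorem exists_hasStrictFDerivAt_dotProduct_mulVec_self {B : Matrix (Fin n) (Fin n) F} (hB : B.IsSymm) (y : Fin n → F) :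
    letI := nontriviallyNormedField F
    ∃ L : (Fin n → F) →L[F] F, (∀ v, L v = 2 * (y ⬝ᵥ B *ᵥ v)) ∧ HasStrictFDerivAt (fun x : Fin n → F => x ⬝ᵥ B *ᵥ x) L y := by
  letI := nontriviallyNormedField F
  haveI : CompleteSpace F := completeSpace_nontriviallyNormedField F
  -- the bilinear form of `B` as a continuous bilinear map (finite dimension)
  let β : (Fin n → F) →L[F] (Fin n → F) →L[F] F :=
    LinearMap.toContinuousLinearMap
      ((LinearMap.toContinuousLinearMap : ((Fin n → F) →ₗ[F] F) ≃ₗ[F] ((Fin n → F) →L[F] F)).toLinearMap ∘ₗ Matrix.toBilin' B)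
  have hβ : ∀ x z : Fin n → F, β x z = x ⬝ᵥ B *ᵥ z := fun x z => by
    simp only [β, LinearMap.coe_toContinuousLinearMap', LinearMap.coe_comp, Function.comp_apply, LinearEquiv.coe_coe,
      Matrix.toBilin'_apply']
  have hb : IsBoundedBilinearMap F (fun p : (Fin n → F) × (Fin n → F) => β p.1 p.2) := β.isBoundedBilinearMap
  have hdiag : HasStrictFDerivAt (fun x : Fin n → F => (x, x))
      ((ContinuousLinearMap.id F (Fin n → F)).prod (ContinuousLinearMap.id F (Fin n → F))) y :=
    (hasStrictFDerivAt_id y).prodMk (hasStrictFDerivAt_id y)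
  refine ⟨(hb.deriv (y, y)).comp ((ContinuousLinearMap.id F (Fin n → F)).prod (ContinuousLinearMap.id F (Fin n → F))), fun v => ?_, ?_⟩
  · simp only [ContinuousLinearMap.comp_apply, ContinuousLinearMap.prod_apply, ContinuousLinearMap.coe_id', id_eq,
      IsBoundedBilinearMap.deriv_apply, hβ, dotProduct_mulVec_symm_of_isSymm hB v y, two_mul]
  · have h := HasStrictFDerivAt.comp (f := fun x : Fin n → F => (x, x)) y (hb.hasStrictFDerivAt (y, y)) hdiag
    simpa only [Function.comp_def, hβ] using h

end Deriv

/-! ## §4 On the zero set off the origin: pull back `∫⁻_𝒪 |a|^{−s} da < ∞` along a submersion (★ FILE A) -/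

section Measure

variable {F : Type*} [Field F] [ValuativeRel F] [TopologicalSpace F] [IsNonarchimedeanLocalField F]
  [MeasurableSpace F] [BorelSpace F] (μ : Measure F) [μ.IsAddHaarMeasure] {n : ℕ}

/-- **Local finiteness of `∫⁻ |P|^{−s}` at a zero of `P` where `P` is a submersion** (`s < 1`): if `P : Fⁿ → F` has, for the valuation norm, a strict derivative `L` at `y`
which is onto, and `P y = 0`, then `y` has a neighbourhood `U` with `∫⁻ x in U, (↑|P x|)^{−s} ∂μⁿ < ∞` — ★ FILE A `exists_nhds_setLIntegral_comp_lt_top` (★ D2 submersion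
chart, ★ D2-lin) applied to `f = |·|^{−s}`, which has finite integral on the neighbourhood `𝒪 = 𝔭⁰` of `0 = P y` (★ (D3a)).
[cite: Schikhof1984, §27] [cite: Tate1950, §2.4] [cite: HarishChandra1970, Part VII §1 Thm. 15] -/
theorem exists_nhds_setLIntegral_rpow_neg_lt_top_of_hasStrictFDerivAt {P : (Fin n → F) → F} {y : Fin n → F} {L : (Fin n → F) →L[F] F}
    (hP : letI := nontriviallyNormedField F; HasStrictFDerivAt P L y) (hL : Function.Surjective L) (hy : P y = 0) {s : ℝ} (hs : s < 1) :
    ∃ U ∈ 𝓝 y, ∫⁻ x in U, ((normAbs F (P x) : ℝ≥0∞)) ^ (-s) ∂(Measure.pi fun _ : Fin n => μ) < ∞ := by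
  letI := nontriviallyNormedField F
  haveI : CompleteSpace F := completeSpace_nontriviallyNormedField F
  haveI : IsUltrametricDist F := isUltrametricDist_nontriviallyNormedField F
  haveI : ProperSpace F := ProperSpace.of_nontriviallyNormedField_of_weaklyLocallyCompactSpace F
  haveI := sigmaCompactSpace_of_isNonarchimedeanLocalField F
  haveI := secondCountableTopology_localField F
  have hf : Measurable fun a : F => ((normAbs F a : ℝ≥0∞)) ^ (-s) :=
    (measurable_normAbs.coe_nnreal_ennreal).pow_const _
  have hfin : ∃ W ∈ 𝓝 (P y), ∫⁻ a in W, ((normAbs F a : ℝ≥0∞)) ^ (-s) ∂μ < ∞ := by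
    refine ⟨primePowBall F 0, ?_, lintegral_coe_normAbs_rpow_neg_lt_top μ hs 0⟩
    rw [hy]
    exact (isOpen_primePowBall 0).mem_nhds (mem_primePowBall_zero_iff.2 (zero_mem _))
  exact exists_nhds_setLIntegral_comp_lt_top (Measure.pi fun _ : Fin n => μ) μ L hP hL hf hfin

/-! ## §5 The exponent bookkeeping and the HEAD -/

omit [MeasurableSpace F] [BorelSpace F] in
/-- `(q^{−D})^{−s} = q^{Ds} < q^{W}` in `ℝ≥0∞` when `s·D < W` (`q > 1` the residue cardinality): the weight of `|·|^{−s}∘(homogeneous of degree D)` under the uniformizer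
dilation against its modulus `q^{−W}`. [cite: WeilBNT1967, Ch. II §1] -/
theorem coe_inv_residueFieldCard_pow_rpow_neg_lt {s : ℝ} {D W : ℕ} (h : s * D < W) :
    ((((residueFieldCard F : ℝ≥0))⁻¹ ^ D : ℝ≥0) : ℝ≥0∞) ^ (-s) < (residueFieldCard F : ℝ≥0∞) ^ W := by
  have hq1 : (1 : ℝ≥0∞) < (residueFieldCard F : ℝ≥0∞) := by exact_mod_cast one_lt_residueFieldCard F
  have hqtop : (residueFieldCard F : ℝ≥0∞) ≠ ⊤ := ENNReal.natCast_ne_top _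
  have hq0 : (residueFieldCard F : ℝ≥0) ≠ 0 := by
    have h1 : (1 : ℝ≥0) < (residueFieldCard F : ℝ≥0) := by exact_mod_cast one_lt_residueFieldCard F
    exact ne_of_gt (lt_trans zero_lt_one h1)
  calc ((((residueFieldCard F : ℝ≥0))⁻¹ ^ D : ℝ≥0) : ℝ≥0∞) ^ (-s)
      = (residueFieldCard F : ℝ≥0∞) ^ ((D : ℝ) * s) := by
        rw [ENNReal.coe_pow, ENNReal.coe_inv hq0, ENNReal.coe_natCast, ← ENNReal.inv_pow, ENNReal.inv_rpow, ENNReal.rpow_neg, inv_inv,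
          ← ENNReal.rpow_natCast, ← ENNReal.rpow_mul]
    _ < (residueFieldCard F : ℝ≥0∞) ^ ((W : ℕ) : ℝ) := ENNReal.rpow_lt_rpow_of_exponent_lt hq1 hqtop (by rwa [mul_comm])
    _ = (residueFieldCard F : ℝ≥0∞) ^ W := ENNReal.rpow_natCast _ _

/-- **(D3b) HEAD — `|Q|^{−s} ∈ L¹_loc(Fⁿ)` for a non-degenerate quadratic form.**  `B : Matrix (Fin n) (Fin n) F` symmetric, `det B ≠ 0`, `(2 : F) ≠ 0`, `n ≠ 0`, `s < 1`,
`2s < n`: every `y : Fin n → F` has a neighbourhood `U` with `∫⁻ x in U, (↑(normAbs F (x ⬝ᵥ B *ᵥ x)))^{−s} ∂(Measure.pi μ) < ∞`.  (Both the split∕isotropic and the anisotropic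
case; for anisotropic `Q` step (2) of the proof is vacuous.) [cite: HarishChandra1970, Part VII §1 Thm. 15] [cite: WeilBNT1967, Ch. II §1] [cite: Tate1950, §2.4] -/
theorem forall_exists_nhds_setLIntegral_quadraticForm_rpow_neg_lt_top {B : Matrix (Fin n) (Fin n) F} (hB : B.IsSymm) (hdet : B.det ≠ 0) (h2 : (2 : F) ≠ 0)
    (hn : n ≠ 0) {s : ℝ} (hs : s < 1) (hsn : 2 * s < n) :
    ∀ y : Fin n → F, ∃ U ∈ 𝓝 y, ∫⁻ x in U, ((normAbs F (x ⬝ᵥ B *ᵥ x) : ℝ≥0∞)) ^ (-s) ∂(Measure.pi fun _ : Fin n => μ) < ∞ := by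
  haveI := secondCountableTopology_localField F
  obtain ⟨ϖ, -, hϖ⟩ := exists_normAbs_eq_inv (F := F)
  have hQc : Continuous fun x : Fin n → F => x ⬝ᵥ B *ᵥ x := continuous_id.dotProduct (continuous_const.matrix_mulVec continuous_id)
  have hgm : Measurable fun x : Fin n → F => ((normAbs F (x ⬝ᵥ B *ᵥ x) : ℝ≥0∞)) ^ (-s) :=
    ((measurable_normAbs.comp hQc.measurable).coe_nnreal_ennreal).pow_const _
  refine exists_nhds_setLIntegral_lt_top_of_dilation μ hϖ (w := fun _ => 1) (fun _ => le_rfl) hn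
    (fun x => ((normAbs F (x ⬝ᵥ B *ᵥ x) : ℝ≥0∞)) ^ (-s)) hgm (κ := ((normAbs F ϖ ^ 2 : ℝ≥0) : ℝ≥0∞) ^ (-s)) ?_ ?_ ?_
  · -- homogeneity: `|Q (ϖ x)|^{−s} = (|ϖ|²)^{−s} |Q x|^{−s}`
    intro x
    have h1 : (fun i => ϖ ^ (1 : ℕ) * x i) = ϖ • x := by
      funext i; rw [pow_one]; rfl
    simp only [h1]
    rw [dotProduct_mulVec_smul_self, map_mul, map_pow, ENNReal.coe_mul,
      ENNReal.mul_rpow_of_ne_top ENNReal.coe_ne_top ENNReal.coe_ne_top]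
  · -- `κ = q^{2s} < q^{n}`
    rw [hϖ]
    exact coe_inv_residueFieldCard_pow_rpow_neg_lt (by simpa using hsn.trans_eq' (mul_comm _ _))
  · -- off the origin: either `Q y ≠ 0` (§1) or `y` is isotropic and `dQ_y` is onto (§3–§4)
    intro y hy
    by_cases hQy : y ⬝ᵥ B *ᵥ y = 0
    · letI := nontriviallyNormedField F
      obtain ⟨L, hL, hQ⟩ := exists_hasStrictFDerivAt_dotProduct_mulVec_self hB y
      have hBy : B *ᵥ y ≠ 0 := fun h => hy (Matrix.eq_zero_of_mulVec_eq_zero hdet h)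
      obtain ⟨i, hi⟩ := Function.ne_iff.1 hBy
      have hLi : L (Pi.single i 1) ≠ 0 := by
        rw [hL, dotProduct_mulVec_single_one_of_isSymm hB]
        exact mul_ne_zero h2 hi
      have hLsurj : Function.Surjective L := fun a =>
        ⟨(a / L (Pi.single i 1)) • Pi.single i 1, by rw [map_smul, smul_eq_mul, div_mul_cancel₀ a hLi]⟩
      exact exists_nhds_setLIntegral_rpow_neg_lt_top_of_hasStrictFDerivAt μ hQ hLsurj hQy hs
    · exact exists_nhds_setLIntegral_rpow_neg_lt_top_of_ne_zero μ hQc s hQy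

/-- **(D3b) at the road's exponent: `|Q|^{−1/2}` on `F³`.**  For a symmetric `B : Matrix (Fin 3) (Fin 3) F` with `det B ≠ 0` and `(2 : F) ≠ 0`, every point of `F³` has a
neighbourhood `U` with `∫⁻ x in U, (↑(normAbs F (x ⬝ᵥ B *ᵥ x)))^{−1/2} ∂(Measure.pi μ) < ∞` — the docking token of bricks D5(ii)∕(CO).
[cite: HarishChandra1970, Part VII §1 Thm. 15] -/
theorem forall_exists_nhds_setLIntegral_quadraticForm_neg_half_lt_top {B : Matrix (Fin 3) (Fin 3) F} (hB : B.IsSymm) (hdet : B.det ≠ 0) (h2 : (2 : F) ≠ 0) :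
    ∀ y : Fin 3 → F, ∃ U ∈ 𝓝 y,
      ∫⁻ x in U, ((normAbs F (x ⬝ᵥ B *ᵥ x) : ℝ≥0∞)) ^ (-(1 / 2 : ℝ)) ∂(Measure.pi fun _ : Fin 3 => μ) < ∞ :=
  forall_exists_nhds_setLIntegral_quadraticForm_rpow_neg_lt_top μ hB hdet h2 (by norm_num) (by norm_num) (by norm_num)

/-- **(D3b), every exponent `s < 1` on `F³`** (so `2s < 3` automatically). [cite: HarishChandra1970, Part VII §1 Thm. 15] -/
theorem forall_exists_nhds_setLIntegral_ternaryQuadraticForm_rpow_neg_lt_top {B : Matrix (Fin 3) (Fin 3) F} (hB : B.IsSymm) (hdet : B.det ≠ 0)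
    (h2 : (2 : F) ≠ 0) {s : ℝ} (hs : s < 1) :
    ∀ y : Fin 3 → F, ∃ U ∈ 𝓝 y, ∫⁻ x in U, ((normAbs F (x ⬝ᵥ B *ᵥ x) : ℝ≥0∞)) ^ (-s) ∂(Measure.pi fun _ : Fin 3 => μ) < ∞ :=
  forall_exists_nhds_setLIntegral_quadraticForm_rpow_neg_lt_top μ hB hdet h2 (by norm_num) hs (by push_cast; linarith)

end Measure

end Summit.HodgeConjecture.HodgeConjecture.Cruxes.H413.F0P3cStCharTSQuadraticFormNegHalf

end
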